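import Mathlib

/-!
# PneNP / OverlapGapAlgebra — crux `SolvableImpliesStableSection` (stmt-PneNP-2463):
# the FILTERED REPAIR block (5/6) — normalisation and asymptotics of the mean bound

Support for crux `stmt-PneNP-2463` (`Summit.PneNP.PneNP.Theses.OverlapGapAlgebra.SolvableImpliesStableSection`).
Pure real analysis, no instances.  (1) `sissF_mean_le_of_count` turns the counting inequality of
`…FilteredRepairMean` (per clause, in `ℕ`) into the normalised mean bound
`#{clause i violated} ≤ #Inst · q`, where, with `X = (2n)^k`, `d = m2^{-k}/n`,
`q = 2^{-k}(1 - (B_up/X)^{m-1}) + C(k,2) Σ_{r<k-1} C(k-2,r) [2^{-k} d^{r+2} (B_{r+2}/X)^{m-3-r} + (r+2)² m/(4^k n²)]`.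
(2) `sissF_asymptotics`: for `m = ⌊αn⌋` and the actual counts `B_up = X - k(n+1)^{k-1}`,
`B_t = X - t k n^{k-1}`, `q` is eventually at most `2^{-k}(1 - e^{-λ}/2)`, `λ = kα2^{-k}`: its limit is
`2^{-k} θ`, `θ = 1 - e^{-λ} + ((k-1)/2k) x² (1 + x/k)^{k-2}`, `x = λe^{-λ}`, and `θ < 1 - e^{-λ}/2` because
`x ≤ 1/e`, `λ²e^{-λ} ≤ 4/e²`, `(1 + x/k)^{k-2} ≤ eˣ ≤ 1/(1-x)` and `e(e-1) > 4` (`sissF_theta_lt`).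
No new definitions; axioms `propext`, `Classical.choice`, `Quot.sound`.
-/

set_option linter.dupNamespace false -- `Summit.PneNP.PneNP.…`: summit = sub-problem (D-0017)

namespace Summit.PneNP.PneNP.Theorems

open Finset Filter
open scoped Classical Topology

section FilteredRepairAsymptotics

/-! ### Normalisation -/

/-- `2^{-k} = n^k/(2n)^k` for `n ≥ 1`. -/
theorem sissF_halfpow (k n : ℕ) (hn : 1 ≤ n) : (1 / 2 : ℝ) ^ k = (n : ℝ) ^ k / (2 * (n : ℝ)) ^ k := by
  have hn0 : (n : ℝ) ≠ 0 := by positivity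
  rw [mul_pow, one_div_pow]
  field_simp

/-- Normalisation of the injective-tuple term. -/
theorem sissF_norm_inj (k m n t : ℕ) (hk : 1 ≤ k) (hn : 1 ≤ n) (hmt : t + 1 ≤ m) (B : ℝ) :
    (n : ℝ) ^ k * ((m : ℝ) ^ t * ((2 * (n : ℝ)) ^ k * ((n : ℝ) ^ (k - 1)) ^ t * B ^ (m - 1 - t)))
      = (2 * (n : ℝ)) ^ k * ((2 * (n : ℝ)) ^ k) ^ m *
        ((1 / 2 : ℝ) ^ k * ((m : ℝ) * (1 / 2 : ℝ) ^ k / n) ^ t * (B / (2 * (n : ℝ)) ^ k) ^ (m - 1 - t)) := by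
  have hn0 : (n : ℝ) ≠ 0 := by positivity
  rw [sissF_halfpow k n hn]
  set X := (2 * (n : ℝ)) ^ k with hX
  have hX0 : X ≠ 0 := by positivity
  have hsplit : X ^ m = X ^ (t + 1) * X ^ (m - 1 - t) := by
    rw [← pow_add]; congr 1; omega
  have hk1 : (n : ℝ) ^ k = (n : ℝ) ^ (k - 1) * n := by
    rw [← pow_succ, Nat.sub_add_cancel hk]
  rw [hsplit, hk1]
  simp only [div_pow, mul_pow]
  field_simp
  ring

/-- Normalisation of the unsafe-variable term. -/
theorem sissF_norm_unsafe (k m n : ℕ) (hn : 1 ≤ n) (hm : 1 ≤ m) (B : ℝ) :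
    (n : ℝ) ^ k * ((2 * (n : ℝ)) ^ k) ^ m - (n : ℝ) ^ k * ((2 * (n : ℝ)) ^ k * B ^ (m - 1))
      = (2 * (n : ℝ)) ^ k * ((2 * (n : ℝ)) ^ k) ^ m *
        ((1 / 2 : ℝ) ^ k * (1 - (B / (2 * (n : ℝ)) ^ k) ^ (m - 1))) := by
  have hn0 : (n : ℝ) ≠ 0 := by positivity
  rw [sissF_halfpow k n hn]
  set X := (2 * (n : ℝ)) ^ k with hX
  have hX0 : X ≠ 0 := by positivity
  have hsplit : X ^ m = X * X ^ (m - 1) := by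
    rw [← pow_succ', Nat.sub_add_cancel hm]
  rw [hsplit, div_pow]
  field_simp

/-- Normalisation (bound) of the coincidence term. -/
theorem sissF_norm_one (k m n r : ℕ) (hk : 1 ≤ k) (hn : 1 ≤ n) (hm : 2 ≤ m) (B : ℝ) (hB0 : 0 ≤ B)
    (hB : B ≤ (2 * (n : ℝ)) ^ k) :
    ((r : ℝ) + 2) * ((r : ℝ) + 2) * (n : ℝ) ^ (k - 1) *
        ((m : ℝ) ^ 1 * ((2 * (n : ℝ)) ^ k * ((n : ℝ) ^ (k - 1)) ^ 1 * B ^ (m - 1 - 1)))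
      ≤ (2 * (n : ℝ)) ^ k * ((2 * (n : ℝ)) ^ k) ^ m * (((r : ℝ) + 2) ^ 2 * m / (4 ^ k * n ^ 2)) := by
  have hn0 : (0 : ℝ) < n := by exact_mod_cast hn
  have hk1 : (n : ℝ) ^ k = (n : ℝ) ^ (k - 1) * n := by
    rw [← pow_succ, Nat.sub_add_cancel hk]
  have hX2 : ((2 * (n : ℝ)) ^ k) ^ 2 = 4 ^ k * (n : ℝ) ^ 2 * ((n : ℝ) ^ (k - 1)) ^ 2 := by
    rw [mul_pow, hk1, show (4 : ℝ) = 2 ^ 2 by norm_num, ← pow_mul, mul_comm 2 k, pow_mul]; ring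
  set X := (2 * (n : ℝ)) ^ k with hX
  have hX0 : 0 < X := by positivity
  have hsplit : X ^ m = X ^ 2 * X ^ (m - 2) := by
    rw [← pow_add]; congr 1; omega
  have hm2 : m - 1 - 1 = m - 2 := by omega
  have hBpow : B ^ (m - 2) ≤ X ^ (m - 2) := pow_le_pow_left₀ hB0 hB _
  rw [hm2, hsplit, pow_one, pow_one, hX2]
  have key : X * (4 ^ k * (n : ℝ) ^ 2 * ((n : ℝ) ^ (k - 1)) ^ 2 * X ^ (m - 2)) *
      (((r : ℝ) + 2) ^ 2 * m / (4 ^ k * n ^ 2))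
      = ((r : ℝ) + 2) * ((r : ℝ) + 2) * (n : ℝ) ^ (k - 1) * ((m : ℝ) * (X * (n : ℝ) ^ (k - 1))) * X ^ (m - 2) := by
    field_simp
  rw [key]
  have h0 : (0 : ℝ) ≤ ((r : ℝ) + 2) * ((r : ℝ) + 2) * (n : ℝ) ^ (k - 1) * ((m : ℝ) * (X * (n : ℝ) ^ (k - 1))) := by
    positivity
  have h1 : ((r : ℝ) + 2) * ((r : ℝ) + 2) * (n : ℝ) ^ (k - 1) * ((m : ℝ) * (X * (n : ℝ) ^ (k - 1) * B ^ (m - 2)))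
      = ((r : ℝ) + 2) * ((r : ℝ) + 2) * (n : ℝ) ^ (k - 1) * ((m : ℝ) * (X * (n : ℝ) ^ (k - 1))) * B ^ (m - 2) := by
    ring
  rw [h1]
  exact mul_le_mul_of_nonneg_left hBpow h0

/-- **Normalised mean bound from the counting inequality.** If, for some counts `B_up` and `B_t`
(`B_1 ≤ (2n)^k`), the counting inequality of `sissF_count_viol_le` holds for `V`, then
`V ≤ #Inst · q(k, m, n)` with `q` as in the module docstring. -/
theorem sissF_mean_le_of_count {k m n : ℕ} (hk : 1 ≤ k) (hn : 1 ≤ n) (hm : k + 1 ≤ m) (V Bup : ℕ)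
    (Bt : ℕ → ℕ) (hB1 : Bt 1 ≤ (2 * n) ^ k)
    (h : (2 * n) ^ k * V + n ^ k * ((2 * n) ^ k * Bup ^ (m - 1))
      ≤ n ^ k * Fintype.card (Fin m → Fin k → Fin n × Bool)
        + k.choose 2 * ∑ r ∈ range (k - 1), (k - 2).choose r *
          (n ^ k * (m ^ (r + 2) * ((2 * n) ^ k * (n ^ (k - 1)) ^ (r + 2) * Bt (r + 2) ^ (m - 1 - (r + 2))))
            + (r + 2) * (r + 2) * n ^ (k - 1) * (m ^ 1 * ((2 * n) ^ k * (n ^ (k - 1)) ^ 1 *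
              Bt 1 ^ (m - 1 - 1))))) :
    (V : ℝ) ≤ (Fintype.card (Fin m → Fin k → Fin n × Bool) : ℝ) *
      ((1 / 2 : ℝ) ^ k * (1 - ((Bup : ℝ) / (2 * (n : ℝ)) ^ k) ^ (m - 1))
        + (k.choose 2 : ℝ) * ∑ r ∈ range (k - 1), ((k - 2).choose r : ℝ) *
          ((1 / 2 : ℝ) ^ k * ((m : ℝ) * (1 / 2 : ℝ) ^ k / n) ^ (r + 2) *
              ((Bt (r + 2) : ℝ) / (2 * (n : ℝ)) ^ k) ^ (m - 1 - (r + 2))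
            + ((r : ℝ) + 2) ^ 2 * m / (4 ^ k * n ^ 2))) := by
  have hn0 : (0 : ℝ) < n := by exact_mod_cast hn
  have hX0 : 0 < (2 * (n : ℝ)) ^ k := by positivity
  have hN : (Fintype.card (Fin m → Fin k → Fin n × Bool) : ℝ) = ((2 * (n : ℝ)) ^ k) ^ m := by
    rw [Fintype.card_fun, Fintype.card_fun, Fintype.card_prod, Fintype.card_fin, Fintype.card_bool,
      Fintype.card_fin, Fintype.card_fin]
    push_cast
    ring
  have h' := (Nat.cast_le (α := ℝ)).2 h
  push_cast at h'
  rw [hN] at h'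
  rw [hN]
  -- the three normalisations
  have hE1 := sissF_norm_unsafe k m n hn (by omega) (Bup : ℝ)
  have hE2 : ∀ r ∈ range (k - 1),
      (n : ℝ) ^ k * ((m : ℝ) ^ (r + 2) * ((2 * (n : ℝ)) ^ k * ((n : ℝ) ^ (k - 1)) ^ (r + 2) *
        (Bt (r + 2) : ℝ) ^ (m - 1 - (r + 2))))
      = (2 * (n : ℝ)) ^ k * ((2 * (n : ℝ)) ^ k) ^ m * ((1 / 2 : ℝ) ^ k *
        ((m : ℝ) * (1 / 2 : ℝ) ^ k / n) ^ (r + 2) *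
        ((Bt (r + 2) : ℝ) / (2 * (n : ℝ)) ^ k) ^ (m - 1 - (r + 2))) := by
    intro r hr
    have hrk : r + 2 + 1 ≤ m := by have := mem_range.1 hr; omega
    exact sissF_norm_inj k m n (r + 2) hk hn hrk _
  have hE3 : ∀ r ∈ range (k - 1),
      ((r : ℝ) + 2) * ((r : ℝ) + 2) * (n : ℝ) ^ (k - 1) *
        ((m : ℝ) ^ 1 * ((2 * (n : ℝ)) ^ k * ((n : ℝ) ^ (k - 1)) ^ 1 * (Bt 1 : ℝ) ^ (m - 1 - 1)))
      ≤ (2 * (n : ℝ)) ^ k * ((2 * (n : ℝ)) ^ k) ^ m * (((r : ℝ) + 2) ^ 2 * m / (4 ^ k * n ^ 2)) := by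
    intro r _
    refine sissF_norm_one k m n r hk hn (by omega) _ (Nat.cast_nonneg _) ?_
    exact_mod_cast hB1
  -- the sum, term by term
  have hsum : ∑ r ∈ range (k - 1), ((k - 2).choose r : ℝ) *
      ((n : ℝ) ^ k * ((m : ℝ) ^ (r + 2) * ((2 * (n : ℝ)) ^ k * ((n : ℝ) ^ (k - 1)) ^ (r + 2) *
          (Bt (r + 2) : ℝ) ^ (m - 1 - (r + 2))))
        + ((r : ℝ) + 2) * ((r : ℝ) + 2) * (n : ℝ) ^ (k - 1) *
          ((m : ℝ) ^ 1 * ((2 * (n : ℝ)) ^ k * ((n : ℝ) ^ (k - 1)) ^ 1 * (Bt 1 : ℝ) ^ (m - 1 - 1))))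
      ≤ (2 * (n : ℝ)) ^ k * ((2 * (n : ℝ)) ^ k) ^ m * ∑ r ∈ range (k - 1), ((k - 2).choose r : ℝ) *
          ((1 / 2 : ℝ) ^ k * ((m : ℝ) * (1 / 2 : ℝ) ^ k / n) ^ (r + 2) *
              ((Bt (r + 2) : ℝ) / (2 * (n : ℝ)) ^ k) ^ (m - 1 - (r + 2))
            + ((r : ℝ) + 2) ^ 2 * m / (4 ^ k * n ^ 2)) := by
    rw [mul_sum]
    refine sum_le_sum fun r hr => ?_
    rw [hE2 r hr]
    have hC : (0 : ℝ) ≤ ((k - 2).choose r : ℝ) := Nat.cast_nonneg _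
    have := hE3 r hr
    nlinarith [mul_le_mul_of_nonneg_left this hC]
  -- combine
  have hmain : (2 * (n : ℝ)) ^ k * (V : ℝ) ≤ (2 * (n : ℝ)) ^ k * (((2 * (n : ℝ)) ^ k) ^ m *
      ((1 / 2 : ℝ) ^ k * (1 - ((Bup : ℝ) / (2 * (n : ℝ)) ^ k) ^ (m - 1))
        + (k.choose 2 : ℝ) * ∑ r ∈ range (k - 1), ((k - 2).choose r : ℝ) *
          ((1 / 2 : ℝ) ^ k * ((m : ℝ) * (1 / 2 : ℝ) ^ k / n) ^ (r + 2) *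
              ((Bt (r + 2) : ℝ) / (2 * (n : ℝ)) ^ k) ^ (m - 1 - (r + 2))
            + ((r : ℝ) + 2) ^ 2 * m / (4 ^ k * n ^ 2)))) := by
    have hC2 : (0 : ℝ) ≤ (k.choose 2 : ℝ) := Nat.cast_nonneg _
    have h2 := mul_le_mul_of_nonneg_left hsum hC2
    nlinarith [h', hE1, h2]
  exact le_of_mul_le_mul_left hmain hX0

/-! ### The limit constant -/

/-- `λ e^{-λ} ≤ 1/e`. -/
theorem sissF_mul_exp_neg_le (L : ℝ) : L * Real.exp (-L) ≤ Real.exp (-1) := by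
  have h := Real.add_one_le_exp (L - 1)
  have h1 : L ≤ Real.exp (L - 1) := by linarith
  have h2 : Real.exp (L - 1) * Real.exp (-L) = Real.exp (-1) := by
    rw [← Real.exp_add]; congr 1; ring
  calc L * Real.exp (-L) ≤ Real.exp (L - 1) * Real.exp (-L) :=
        mul_le_mul_of_nonneg_right h1 (Real.exp_pos _).le
    _ = Real.exp (-1) := h2

/-- `λ² e^{-λ} ≤ 4/e²` for `λ ≥ 0`. -/
theorem sissF_sq_mul_exp_neg_le (L : ℝ) (hL : 0 ≤ L) : L ^ 2 * Real.exp (-L) ≤ 4 * Real.exp (-2) := by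
  have h := Real.add_one_le_exp ((L - 2) / 2)
  have h1 : L / 2 ≤ Real.exp ((L - 2) / 2) := by linarith
  have h2 : (L / 2) ^ 2 ≤ Real.exp ((L - 2) / 2) ^ 2 := pow_le_pow_left₀ (by linarith) h1 2
  have h3 : Real.exp ((L - 2) / 2) ^ 2 = Real.exp (L - 2) := by
    rw [← Real.exp_nat_mul]; congr 1; ring
  have h4 : Real.exp (L - 2) * Real.exp (-L) = Real.exp (-2) := by
    rw [← Real.exp_add]; congr 1; ring
  nlinarith [Real.exp_pos (-L), h2, h3, h4]

/-- `e (e - 1) > 4`. -/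
theorem sissF_exp_one_mul_gt : 4 < Real.exp 1 * (Real.exp 1 - 1) := by
  have h := Real.exp_one_gt_d9
  nlinarith

/-- **The limit constant is below the target.** For `λ > 0` and `k ≥ 2`, with `x = λe^{-λ}`:
`(1 - e^{-λ}) + C(k,2) Σ_{r<k-1} C(k-2,r) (λ/k)^{r+2} e^{-(r+2)λ} < 1 - e^{-λ}/2`. -/
theorem sissF_theta_lt (k : ℕ) (hk2 : 2 ≤ k) (L : ℝ) (hL : 0 < L) :
    (1 - Real.exp (-L)) + (k.choose 2 : ℝ) * ∑ r ∈ range (k - 1), ((k - 2).choose r : ℝ) *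
        ((L / k) ^ (r + 2) * Real.exp (-((r + 2 : ℕ) * L)))
      < 1 - Real.exp (-L) / 2 := by
  have hkR : (2 : ℝ) ≤ k := by exact_mod_cast hk2
  have hk0 : (0 : ℝ) < k := by linarith
  set x : ℝ := L * Real.exp (-L) with hx
  have hx0 : 0 ≤ x := by positivity
  have hx1 : x ≤ Real.exp (-1) := sissF_mul_exp_neg_le L
  have hxe : x < 1 := by
    have : Real.exp (-1) < 1 := Real.exp_lt_one_iff.2 (by norm_num)
    linarith
  -- the sum is `(x/k)² (1 + x/k)^{k-2}`
  have hterm : ∀ r : ℕ, (L / k) ^ (r + 2) * Real.exp (-((r + 2 : ℕ) * L)) = (x / k) ^ (r + 2) := by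
    intro r
    rw [hx, show L * Real.exp (-L) / k = (L / k) * Real.exp (-L) by ring, mul_pow, ← Real.exp_nat_mul,
      show -(((r + 2 : ℕ) : ℝ) * L) = ((r + 2 : ℕ) : ℝ) * -L by ring]
  have hsum : ∑ r ∈ range (k - 1), ((k - 2).choose r : ℝ) * ((L / k) ^ (r + 2) * Real.exp (-((r + 2 : ℕ) * L)))
      = (x / k) ^ 2 * (1 + x / k) ^ (k - 2) := by
    simp_rw [hterm]
    have hk21 : k - 1 = k - 2 + 1 := by omega
    rw [hk21, add_comm (1 : ℝ), add_pow, mul_sum]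
    refine sum_congr rfl fun r _ => ?_
    rw [one_pow, mul_one]; ring
  rw [hsum]
  -- `(1 + x/k)^{k-2} ≤ eˣ ≤ 1/(1 - x)`
  have hpow : (1 + x / k) ^ (k - 2) ≤ Real.exp x := by
    have h1 : (1 + x / k) ^ (k - 2) ≤ Real.exp (x / k) ^ (k - 2) :=
      pow_le_pow_left₀ (by positivity) (by linarith [Real.add_one_le_exp (x / k)]) _
    have h2 : Real.exp (x / k) ^ (k - 2) = Real.exp (((k - 2 : ℕ) : ℝ) * (x / k)) := by
      rw [← Real.exp_nat_mul]
    have h3 : ((k - 2 : ℕ) : ℝ) * (x / k) ≤ x := by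
      have hk2R : ((k - 2 : ℕ) : ℝ) = (k : ℝ) - 2 := by
        rw [Nat.cast_sub hk2]; norm_num
      have e : (k : ℝ) * (x / k) = x := by field_simp
      have : (0 : ℝ) ≤ 2 * (x / k) := by positivity
      rw [hk2R, sub_mul, e]; linarith
    rw [h2] at h1
    exact h1.trans (Real.exp_le_exp.2 h3)
  have hexp : Real.exp x ≤ 1 / (1 - x) := by
    have h := Real.add_one_le_exp (-x)
    rw [le_div_iff₀ (by linarith), mul_comm]
    have : Real.exp (-x) * Real.exp x = 1 := by rw [← Real.exp_add]; simp
    nlinarith [Real.exp_pos x]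
  -- `C(k,2) (x/k)² = ((k-1)/(2k)) x² ≤ x²/2`
  have hchoose : (k.choose 2 : ℝ) * (x / k) ^ 2 ≤ x ^ 2 / 2 := by
    rw [Nat.cast_choose_two, div_pow]
    have hk1 : ((k : ℝ) - 1) ≤ k := by linarith
    rw [div_mul_div_comm, div_le_div_iff₀ (by positivity) (by positivity)]
    nlinarith [sq_nonneg x, hk0]
  -- `x² ≤ 4 e^{-2} e^{-L}`
  have hx2 : x ^ 2 ≤ 4 * Real.exp (-2) * Real.exp (-L) := by
    have h := sissF_sq_mul_exp_neg_le L hL.le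
    have e : x ^ 2 = L ^ 2 * Real.exp (-L) * Real.exp (-L) := by
      rw [hx]; ring
    rw [e]
    exact mul_le_mul_of_nonneg_right h (Real.exp_pos _).le
  -- numerics: `4 e^{-2} / (2 (1 - 1/e)) < 1/2`
  have hE := sissF_exp_one_mul_gt
  have he1 : Real.exp (-1) = (Real.exp 1)⁻¹ := Real.exp_neg 1
  have he2 : Real.exp (-2) = (Real.exp 1)⁻¹ ^ 2 := by
    rw [← Real.exp_neg, ← Real.exp_nat_mul]; norm_num
  have hepos : 0 < Real.exp 1 := Real.exp_pos 1
  -- main chain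
  have hDmg : (k.choose 2 : ℝ) * ((x / k) ^ 2 * (1 + x / k) ^ (k - 2))
      ≤ x ^ 2 / 2 * (1 / (1 - x)) := by
    calc (k.choose 2 : ℝ) * ((x / k) ^ 2 * (1 + x / k) ^ (k - 2))
        = (k.choose 2 : ℝ) * (x / k) ^ 2 * (1 + x / k) ^ (k - 2) := by ring
      _ ≤ x ^ 2 / 2 * (1 + x / k) ^ (k - 2) := mul_le_mul_of_nonneg_right hchoose (by positivity)
      _ ≤ x ^ 2 / 2 * (1 / (1 - x)) :=
          mul_le_mul_of_nonneg_left (hpow.trans hexp) (by positivity)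
  have hfin : x ^ 2 / 2 * (1 / (1 - x)) < Real.exp (-L) / 2 := by
    have h1x : 0 < 1 - x := by linarith
    rw [← mul_div_assoc, mul_one, div_div, div_lt_div_iff₀ (by positivity) two_pos]
    -- x² · 2 < e^{-L} · (2 (1 - x))  ⇐  x² ≤ 4e^{-2}e^{-L}, x ≤ 1/e, e(e-1) > 4
    have hxle : 1 - Real.exp (-1) ≤ 1 - x := by linarith
    have hA : x ^ 2 * 2 ≤ 8 * Real.exp (-2) * Real.exp (-L) := by nlinarith [hx2]
    have hB : 8 * Real.exp (-2) < 2 * (1 - Real.exp (-1)) := by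
      rw [he1, he2]
      rw [inv_pow, ← one_div, ← one_div]
      rw [div_eq_mul_inv, show (1 : ℝ) / Real.exp 1 = (Real.exp 1)⁻¹ from one_div _]
      have hsq : 0 < Real.exp 1 ^ 2 := by positivity
      rw [show (8 : ℝ) * (1 * (Real.exp 1 ^ 2)⁻¹) = 8 / Real.exp 1 ^ 2 by ring,
        show (2 : ℝ) * (1 - (Real.exp 1)⁻¹) = 2 * (Real.exp 1 - 1) / Real.exp 1 by field_simp,
        div_lt_div_iff₀ hsq hepos]
      nlinarith [hE, hepos]
    have hC : 0 < Real.exp (-L) := Real.exp_pos _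
    calc x ^ 2 * 2 ≤ 8 * Real.exp (-2) * Real.exp (-L) := hA
      _ < 2 * (1 - Real.exp (-1)) * Real.exp (-L) := mul_lt_mul_of_pos_right hB hC
      _ ≤ 2 * (1 - x) * Real.exp (-L) := by
          refine mul_le_mul_of_nonneg_right ?_ hC.le
          linarith
      _ = Real.exp (-L) * (2 * (1 - x)) := by ring
  linarith [hDmg, hfin]

end FilteredRepairAsymptotics

end Summit.PneNP.PneNP.Theorems
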